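import Literature.Analysis.FluidPDE.NSRobustnessOfRegularityAgmonParamFlux
import Literature.Analysis.FluidPDE.NSRobustnessOfRegularityHalfFlux
import HarnessLib

/-!
# Robustness of regularity on `ℝ³`, `AgmonBoundR3` RE-THREAD II: the `H¹` robustness theorem in strain form,
# its window form and the majorant (`of_le`) form, with the Agmon constant as a PARAMETER

Analysis/FluidPDE proof file (theorems only; no definitions, no named facts, no `sorry`); second file of the
re-thread of the vein over `(hA : AgmonBoundR3 A)` (see `NSRobustnessOfRegularityAgmonParamFlux`). VERBATIM copies of
`classicalNS_robustness_strain_R3`, `classicalNS_robustness_strain_window_R3`,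
`classicalNS_robustness_strain_window_of_le_R3` (RRS 2016 Thm 9.1 / Dashti–Robinson 2008 Thm 1, strain form) with
`agmonConst ↦ A`: `β = A⁴/(2ν³)` in every smallness hypothesis and bound; the slice bound is
`robustness_flux_le_strain_of_agmonBound`; the comparison step is the vein's PUBLIC
`classicalNS_robustness_apriori_R3` (generic in `β`). Private bookkeeping lemmas are copied; the force-in-`L²` lemma is
the public `IsClassicalNSSolutionOn.lintegral_enorm_sq_force_slice_lt_top` (`NSRobustnessOfRegularityHalfFlux`).

* `classicalNS_robustness_strain_of_agmonBound`, `classicalNS_robustness_strain_window_of_agmonBound`,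
  `classicalNS_robustness_strain_window_of_le_of_agmonBound`.

WHAT THIS IS NOT: not a statement about Navier–Stokes regularity or blow-up — a-priori calculus between two
GIVEN classical solutions. Consumer: the numeral certificate letters of crux 20303 (`EpisodeBaseT`), cell `ns-blowup`.

## References

* J. C. Robinson, J. L. Rodrigo, W. Sadowski, *The Three-Dimensional Navier–Stokes Equations*, CUP 2016,
  Thm 9.1 (proof) and Exercise 9.4. [RobinsonRodrigoSadowskiCUP2016]
* M. Dashti, J. C. Robinson, SIAM J. Numer. Anal. 46 (2008) 3136–3150, Thm 1, Lemma 1. [DashtiRobinson2008]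
-/

noncomputable section

open MeasureTheory Set Function Filter Topology InnerProductSpace
open scoped ENNReal NNReal ContDiff RealInnerProductSpace Laplacian

namespace Literature.Analysis.FluidPDE

/-! ## §A Bookkeeping (copies of the vein's private lemmas) -/

/-- `∫⁻‖a − b‖² < ∞` from `∫⁻‖a‖², ∫⁻‖b‖² < ∞`. [folklore] -/
private theorem agp_lintegral_sq_sub_lt_top {G : Type*} [NormedAddCommGroup G]
    {a b : EuclideanSpace ℝ (Fin 3) → G}
    (ham : AEStronglyMeasurable a volume) (ha : ∫⁻ x, ‖a x‖ₑ ^ 2 < ⊤)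
    (hb : ∫⁻ x, ‖b x‖ₑ ^ 2 < ⊤) : ∫⁻ x, ‖a x - b x‖ₑ ^ 2 < ⊤ :=
  lt_of_le_of_lt (lintegral_enorm_sq_sub_le (g := b) ham (μ := volume))
    (ENNReal.add_lt_top.2 ⟨ENNReal.mul_lt_top (by simp) ha, ENNReal.mul_lt_top (by simp) hb⟩)

/-- Uniform `L²`-Sobolev bounds pass to slicewise differences: if `c(t) = a(t) − b(t)` on `S` with
smooth slices and `a, b` have all `L²` Sobolev norms bounded on `S`, so does `c`. [folklore] -/
private theorem agp_sobolev_sub {F : Type*} [NormedAddCommGroup F] [NormedSpace ℝ F]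
    {S : Set ℝ} {a b c : ℝ → EuclideanSpace ℝ (Fin 3) → F}
    (habc : ∀ t ∈ S, ∀ x, c t x = a t x - b t x) (ha : ∀ t ∈ S, ContDiff ℝ ∞ (a t))
    (hb : ∀ t ∈ S, ContDiff ℝ ∞ (b t))
    (hA : ∀ n : ℕ, ∃ C : ℝ≥0, ∀ t ∈ S, ∫⁻ x, ‖iteratedFDeriv ℝ n (a t) x‖ₑ ^ 2 ≤ C)
    (hB : ∀ n : ℕ, ∃ C : ℝ≥0, ∀ t ∈ S, ∫⁻ x, ‖iteratedFDeriv ℝ n (b t) x‖ₑ ^ 2 ≤ C) (n : ℕ) :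
    ∃ C : ℝ≥0, ∀ t ∈ S, ∫⁻ x, ‖iteratedFDeriv ℝ n (c t) x‖ₑ ^ 2 ≤ C := by
  obtain ⟨Ca, hCa⟩ := hA n
  obtain ⟨Cb, hCb⟩ := hB n
  refine ⟨2 * Ca + 2 * Cb, fun t ht => ?_⟩
  have hc : c t = a t - b t := funext fun x => by rw [Pi.sub_apply, habc t ht x]
  have hsub : ∀ x, iteratedFDeriv ℝ n (c t) x = iteratedFDeriv ℝ n (a t) x - iteratedFDeriv ℝ n (b t) x :=
    fun x => by
      rw [hc]
      exact iteratedFDeriv_sub_apply ((ha t ht).of_le (by exact_mod_cast le_top)).contDiffAt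
        ((hb t ht).of_le (by exact_mod_cast le_top)).contDiffAt
  have hm : AEStronglyMeasurable (fun x => iteratedFDeriv ℝ n (a t) x) volume :=
    ((ha t ht).continuous_iteratedFDeriv (by exact_mod_cast le_top)).aestronglyMeasurable
  calc ∫⁻ x, ‖iteratedFDeriv ℝ n (c t) x‖ₑ ^ 2
      = ∫⁻ x, ‖iteratedFDeriv ℝ n (a t) x - iteratedFDeriv ℝ n (b t) x‖ₑ ^ 2 :=
        lintegral_congr fun x => by rw [hsub]
    _ ≤ 2 * (∫⁻ x, ‖iteratedFDeriv ℝ n (a t) x‖ₑ ^ 2) + 2 * ∫⁻ x, ‖iteratedFDeriv ℝ n (b t) x‖ₑ ^ 2 :=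
        lintegral_enorm_sq_sub_le hm
    _ ≤ 2 * (Ca : ℝ≥0∞) + 2 * (Cb : ℝ≥0∞) := by
        gcongr
        · exact hCa t ht
        · exact hCb t ht
    _ = ((2 * Ca + 2 * Cb : ℝ≥0) : ℝ≥0∞) := by push_cast; rfl

/-- Order-zero Sobolev bound, unfolded: `∫⁻‖g‖² < ∞`. [folklore] -/
private theorem agp_l2_of_order_zero {F : Type*} [NormedAddCommGroup F] [NormedSpace ℝ F]
    {g : EuclideanSpace ℝ (Fin 3) → F} {C : ℝ≥0} (h : ∫⁻ x, ‖iteratedFDeriv ℝ 0 g x‖ₑ ^ 2 ≤ C) :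
    ∫⁻ x, ‖g x‖ₑ ^ 2 < ⊤ := by
  refine lt_of_le_of_lt ((le_of_eq (lintegral_congr fun x => ?_)).trans h) ENNReal.coe_lt_top
  rw [← ofReal_norm, ← ofReal_norm, norm_iteratedFDeriv_zero]

/-- Uniform-in-time Sobolev bound, at one time: `∫⁻‖Dⁿ(c t)‖² < ∞`. [folklore] -/
private theorem agp_fin {F : Type*} [NormedAddCommGroup F] [NormedSpace ℝ F] {S : Set ℝ}
    {c : ℝ → EuclideanSpace ℝ (Fin 3) → F} {t : ℝ} (ht : t ∈ S) (n : ℕ)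
    (hC : ∃ C : ℝ≥0, ∀ s ∈ S, ∫⁻ x, ‖iteratedFDeriv ℝ n (c s) x‖ₑ ^ 2 ≤ C) :
    ∫⁻ x, ‖iteratedFDeriv ℝ n (c t) x‖ₑ ^ 2 < ⊤ := by
  obtain ⟨C, hC⟩ := hC
  exact lt_of_le_of_lt (hC t ht) ENNReal.coe_lt_top

/-- FTC within `[0, T]`: for `φ` continuous on `[0, T]`, `r ↦ ∫₀ʳ φ` has the one-sided
derivative `φ(t)` within `[0, T]` at every `t ∈ [0, T]` (copy of the private lemma of
`TorusNSAPosterioriRegularity`). [folklore] -/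
private theorem agp_hasDerivWithinAt_intervalIntegral {φ : ℝ → ℝ} {T t : ℝ}
    (hφ : ContinuousOn φ (Icc 0 T)) (ht : t ∈ Icc 0 T) :
    HasDerivWithinAt (fun r => ∫ x in (0 : ℝ)..r, φ x) (φ t) (Icc 0 T) t := by
  haveI : Fact (t ∈ Icc 0 T) := ⟨ht⟩
  have hint : IntervalIntegrable φ volume 0 t :=
    (hφ.mono (Icc_subset_Icc_right ht.2)).intervalIntegrable_of_Icc ht.1
  exact intervalIntegral.integral_hasDerivWithinAt_right hint
    (hφ.stronglyMeasurableAtFilter_nhdsWithin measurableSet_Icc t) (hφ t ht)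

/-- Monotonicity of the comparison bound `e^{E}η/√(1 − cη²t)` in `η` (copy of the private lemma
of `TorusNSAPosterioriRegularity`, the case used here). [folklore] -/
private theorem agp_bound_mono {c η η' t E : ℝ} (hc : 0 ≤ c) (hη : 0 ≤ η) (hηη' : η ≤ η')
    (ht0 : 0 ≤ t) (hpos : 0 < 1 - c * η' ^ 2 * t) :
    Real.exp E * η / Real.sqrt (1 - c * η ^ 2 * t) ≤
      Real.exp E * η' / Real.sqrt (1 - c * η' ^ 2 * t) := by
  have h1 : c * η ^ 2 * t ≤ c * η' ^ 2 * t :=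
    mul_le_mul_of_nonneg_right (mul_le_mul_of_nonneg_left (pow_le_pow_left₀ hη hηη' 2) hc) ht0
  have hη' : 0 ≤ η' := hη.trans hηη'
  have hnum : Real.exp E * η ≤ Real.exp E * η' := mul_le_mul_of_nonneg_left hηη' (Real.exp_pos _).le
  have hden : Real.sqrt (1 - c * η' ^ 2 * t) ≤ Real.sqrt (1 - c * η ^ 2 * t) :=
    Real.sqrt_le_sqrt (by linarith)
  calc Real.exp E * η / Real.sqrt (1 - c * η ^ 2 * t)
      ≤ Real.exp E * η' / Real.sqrt (1 - c * η ^ 2 * t) :=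
        div_le_div_of_nonneg_right hnum (Real.sqrt_nonneg _)
    _ ≤ Real.exp E * η' / Real.sqrt (1 - c * η' ^ 2 * t) :=
        div_le_div_of_nonneg_left (mul_nonneg (Real.exp_pos _).le hη') (Real.sqrt_pos.2 hpos) hden

section Robustness

variable {ν T : ℝ} {f g u v : ℝ → EuclideanSpace ℝ (Fin 3) → EuclideanSpace ℝ (Fin 3)}
variable {p q : ℝ → EuclideanSpace ℝ (Fin 3) → ℝ}

/-- A bound `G` of the compression rate `−⟪Du ξ, ξ⟫/‖ξ‖²` of a divergence-free field on `ℝ³` is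
nonnegative: the trace `Σᵢ⟪Du eᵢ, eᵢ⟫ = div u` vanishes. [folklore] -/
private theorem compressionRate_nonneg_of_isDivFree
    {u₀ : EuclideanSpace ℝ (Fin 3) → EuclideanSpace ℝ (Fin 3)} (hdiv : VectorCalculus.IsDivFree u₀)
    {G : ℝ} (hG : ∀ (x ξ : EuclideanSpace ℝ (Fin 3)), -⟪fderiv ℝ u₀ x ξ, ξ⟫ ≤ G * ‖ξ‖ ^ 2) : 0 ≤ G
    := by
  have hd := hdiv 0
  rw [divergence_eq_sum_inner_fderiv (EuclideanSpace.basisFun (Fin 3) ℝ), Fin.sum_univ_three] at hd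
  have he : ∀ i, ‖EuclideanSpace.basisFun (Fin 3) ℝ i‖ = 1 := fun i => by simp
  have h0 := hG 0 (EuclideanSpace.basisFun (Fin 3) ℝ 0)
  have h1 := hG 0 (EuclideanSpace.basisFun (Fin 3) ℝ 1)
  have h2 := hG 0 (EuclideanSpace.basisFun (Fin 3) ℝ 2)
  rw [he, one_pow, mul_one, real_inner_comm] at h0 h1 h2
  linarith

/-- **Robustness of regularity on `ℝ³` in STRAIN form (the transport-free rate), a priori.**
In the setting of `classicalNS_robustness_apriori_R3`, let continuous majorants on `[0, T]` be
given: `G(s) ≥ sup_x λ_max(−sym Du(s, x))` (precisely `−⟪Du(s,x)ξ, ξ⟫ ≤ G(s)‖ξ‖²`),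
`σ₂(s) ≥ sup_x ‖D²u(s, x)‖`, `L(s) ≥ ‖v(s) − u(s)‖_{L²}` (an `L²`-level input, e.g. from the
`L²` stability estimate), `ψ(s) ≥ (2/ν)‖f(s) − g(s)‖²_{L²} + (3σ₂(s)/κ)L(s)²`, `κ > 0` a free
length, and put `λ = 4G + 3κσ₂`, `β = A⁴/(2ν³)` (`A` any constant with `AgmonBoundR3 A`), `Λ' = λ`, `Φ' = φ ≥ e^{−Λ}ψ`,
`η = ∫|∇(v − u)(0)|²_F + Φ(T)`. If `2βe^{2Λ(T)}η²T < 1` then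
`∫|∇(v − u)(t)|²_F ≤ e^{Λ(t)}η/√(1 − 2βe^{2Λ(T)}η²t)` on `[0, T]`. The sup of `u` and the
`M²/ν` rate of the printed proof do not enter (`robustness_flux_le_strain_R3`).
[cite: RobinsonRodrigoSadowskiCUP2016, Thm 9.1 (proof) and Exercise 9.4; DashtiRobinson2008, Thm 1] -/
theorem classicalNS_robustness_strain_of_agmonBound {A : ℝ} (hA : AgmonBoundR3 A) (hν : 0 < ν) (hT : 0 < T)
    (hv : IsClassicalNSSolutionOn (Icc 0 T) ν g v q) (hu : IsClassicalNSSolutionOn (Icc 0 T) ν f u p)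
    (hU : HasBoundedSobolevNormsOn (Icc 0 T) u)
    (hUt : HasBoundedSobolevNormsOn (Icc 0 T) (timeDerivWithin (Icc 0 T) u))
    (hp : ∀ n : ℕ, ∃ C : ℝ≥0, ∀ t ∈ Icc 0 T, ∫⁻ x, ‖iteratedFDeriv ℝ n (p t) x‖ₑ ^ 2 ≤ C)
    (hV : HasBoundedSobolevNormsOn (Icc 0 T) v)
    (hVt : HasBoundedSobolevNormsOn (Icc 0 T) (timeDerivWithin (Icc 0 T) v))
    (hq : ∀ n : ℕ, ∃ C : ℝ≥0, ∀ t ∈ Icc 0 T, ∫⁻ x, ‖iteratedFDeriv ℝ n (q t) x‖ₑ ^ 2 ≤ C)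
    {G σ₂ L ψ Λ Φ φ : ℝ → ℝ} {κ : ℝ} (hκ : 0 < κ)
    (hG : ∀ s ∈ Icc 0 T, ∀ (x ξ : EuclideanSpace ℝ (Fin 3)), -⟪fderiv ℝ (u s) x ξ, ξ⟫ ≤ G s * ‖ξ‖ ^ 2)
    (hσ₂ : ∀ s ∈ Icc 0 T, ∀ x, ‖iteratedFDeriv ℝ 2 (u s) x‖ ≤ σ₂ s)
    (hL : ∀ s ∈ Icc 0 T, Real.sqrt (∫ x, ‖(v - u) s x‖ ^ 2) ≤ L s)
    (hψ : ∀ s ∈ Icc 0 T, 2 / ν * (∫ x, ‖f s x - g s x‖ ^ 2) + 3 * σ₂ s / κ * L s ^ 2 ≤ ψ s)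
    (hGc : ContinuousOn G (Icc 0 T)) (hσc : ContinuousOn σ₂ (Icc 0 T))
    (hψc : ContinuousOn ψ (Icc 0 T))
    (hΛ : ∀ s ∈ Icc 0 T, HasDerivWithinAt Λ (4 * G s + 3 * κ * σ₂ s) (Icc 0 T) s) (hΛ0 : Λ 0 = 0)
    (hΦ : ∀ s ∈ Icc 0 T, HasDerivWithinAt Φ (φ s) (Icc 0 T) s) (hΦ0 : Φ 0 = 0)
    (hφ : ∀ s ∈ Icc 0 T, Real.exp (-Λ s) * ψ s ≤ φ s)
    (hsmall : 2 * (A ^ 4 / (2 * ν ^ 3) * Real.exp (2 * Λ T)) *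
      ((∫ x, frobeniusNormSq (fderiv ℝ ((v - u) 0) x)) + Φ T) ^ 2 * T < 1)
    {t : ℝ} (ht : t ∈ Icc 0 T) :
    ∫ x, frobeniusNormSq (fderiv ℝ ((v - u) t) x) ≤
      Real.exp (Λ t) * ((∫ x, frobeniusNormSq (fderiv ℝ ((v - u) 0) x)) + Φ T) /
        Real.sqrt (1 - 2 * (A ^ 4 / (2 * ν ^ 3) * Real.exp (2 * Λ T)) *
          ((∫ x, frobeniusNormSq (fderiv ℝ ((v - u) 0) x)) + Φ T) ^ 2 * t) := by
  have hU' : UniqueDiffOn ℝ (Icc 0 T) := uniqueDiffOn_Icc hT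
  -- (qualitative) sup bounds of the reference field and its gradient
  obtain ⟨Bu, hBu⟩ := linfty_bound_of_hasBoundedSobolevNormsOn_holds
    (fun s hs => (hu.contDiff_velocity hs).of_le (by norm_cast)) hU
  obtain ⟨B₁, -, hB₁⟩ := exists_forall_norm_fderiv_le_of_hasBoundedSobolevNormsOn
    (fun s hs => (hu.contDiff_velocity hs).of_le (by norm_cast)) hU
  -- smoothness and Sobolev data of `w = v − u` and of the forces
  have hwsm : IsSmoothSpaceTimeOn (Icc 0 T) (v - u) := hv.smooth_velocity.sub hu.smooth_velocity
  have hwsob : ∀ n : ℕ, ∃ C : ℝ≥0, ∀ s ∈ Icc 0 T, ∫⁻ x, ‖iteratedFDeriv ℝ n ((v - u) s) x‖ₑ ^ 2 ≤ C :=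
    agp_sobolev_sub (fun s _ x => rfl) (fun s hs => hv.contDiff_velocity hs)
      (fun s hs => hu.contDiff_velocity hs) hV hU
  have hfsm : IsSmoothSpaceTimeOn (Icc 0 T) f := hu.isSmoothSpaceTimeOn_force hU'
  have hgsm : IsSmoothSpaceTimeOn (Icc 0 T) g := hv.isSmoothSpaceTimeOn_force hU'
  -- signs and continuity of the rates
  have hσ0 : ∀ s ∈ Icc 0 T, 0 ≤ σ₂ s := fun s hs => (norm_nonneg _).trans (hσ₂ s hs 0)
  have hG0 : ∀ s ∈ Icc 0 T, 0 ≤ G s := fun s hs =>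
    compressionRate_nonneg_of_isDivFree (hu.divFree s hs) (hG s hs)
  have hl0 : ∀ s ∈ Icc 0 T, 0 ≤ 4 * G s + 3 * κ * σ₂ s := fun s hs => by
    have := hG0 s hs
    have := hσ0 s hs
    positivity
  have hψ0 : ∀ s ∈ Icc 0 T, 0 ≤ ψ s := fun s hs => by
    refine le_trans ?_ (hψ s hs)
    have : 0 ≤ ∫ x, ‖f s x - g s x‖ ^ 2 := integral_nonneg fun x => sq_nonneg _
    have := hσ0 s hs
    positivity
  have hlc : ContinuousOn (fun s => 4 * G s + 3 * κ * σ₂ s) (Icc 0 T) :=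
    (continuousOn_const.mul hGc).add (continuousOn_const.mul hσc)
  -- the slice bound in strain form along the two solutions
  have hflux : ∀ s ∈ Icc 0 T,
      -(2 * ν * ∫ x, ‖(Δ ((v - u) s)) x‖ ^ 2) +
          2 * (∫ x, ⟪convect (v s) ((v - u) s) x + convect ((v - u) s) (u s) x,
            (Δ ((v - u) s)) x⟫) +
          2 * (∫ x, ⟪f s x - g s x, (Δ ((v - u) s)) x⟫) ≤
        (4 * G s + 3 * κ * σ₂ s) * (∫ x, frobeniusNormSq (fderiv ℝ ((v - u) s) x)) +
          A ^ 4 / (2 * ν ^ 3) * (∫ x, frobeniusNormSq (fderiv ℝ ((v - u) s) x)) ^ 3 +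
          ψ s := by
    intro s hs
    have hw : ContDiff ℝ ∞ ((v - u) s) := hwsm.contDiff_slice hs
    have ch : Continuous fun x => f s x - g s x :=
      (hfsm.contDiff_slice hs).continuous.sub (hgsm.contDiff_slice hs).continuous
    have hh0 : ∫⁻ x, ‖f s x - g s x‖ₑ ^ 2 < ⊤ :=
      agp_lintegral_sq_sub_lt_top (hfsm.contDiff_slice hs).continuous.aestronglyMeasurable
        (hu.lintegral_enorm_sq_force_slice_lt_top hU' hU hUt hp hs)
        (hv.lintegral_enorm_sq_force_slice_lt_top hU' hV hVt hq hs)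
    have key := robustness_flux_le_strain_of_agmonBound hA hν (hu.contDiff_velocity hs) hw ch (hu.divFree s hs)
      (fun n => agp_fin hs n (hwsob n)) hh0 (hBu s hs) (hB₁ s hs) (hG s hs) (hσ₂ s hs) (hL s hs) hκ
    have e : (fun y => u s y + (v - u) s y) = v s := by
      funext y
      simp only [Pi.sub_apply]
      abel
    rw [e] at key
    have hψs := hψ s hs
    generalize (∫ x, frobeniusNormSq (fderiv ℝ ((v - u) s) x)) = X at key ⊢
    generalize (∫ x, ‖(Δ ((v - u) s)) x‖ ^ 2) = Y at key ⊢
    generalize (∫ x, ⟪convect (v s) ((v - u) s) x + convect ((v - u) s) (u s) x,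
      (Δ ((v - u) s)) x⟫) = Pa at key ⊢
    generalize (∫ x, ⟪f s x - g s x, (Δ ((v - u) s)) x⟫) = Pb at key ⊢
    generalize (∫ x, ‖f s x - g s x‖ ^ 2) = H at key hψs
    have hid : A ^ 4 * X ^ 3 / (2 * ν ^ 3) = A ^ 4 / (2 * ν ^ 3) * X ^ 3 := by
      ring
    linarith
  exact classicalNS_robustness_apriori_R3 hT hv hu hU hUt hp hV hVt hq (by positivity) hlc hψc hl0
    hψ0 hflux hΛ hΛ0 hΦ hΦ0 hφ hsmall ht

end Robustness

/-! ## §12 Window-generic form with integral envelopes (the shape a windowed certificate checks) -/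

section Window

variable {ν t₀ t₁ : ℝ} {f g u v : ℝ → EuclideanSpace ℝ (Fin 3) → EuclideanSpace ℝ (Fin 3)}
variable {p q : ℝ → EuclideanSpace ℝ (Fin 3) → ℝ}

/-- Slicewise Sobolev bounds translate in time. [folklore] -/
private theorem agp_bounds_comp_add {G' : Type*} [NormedAddCommGroup G'] [NormedSpace ℝ G']
    {w : ℝ → EuclideanSpace ℝ (Fin 3) → G'} {a b s : ℝ}
    (h : ∀ n : ℕ, ∃ C : ℝ≥0, ∀ t ∈ Icc (a + s) (b + s), ∫⁻ x, ‖iteratedFDeriv ℝ n (w t) x‖ₑ ^ 2 ≤ C) :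
    ∀ n : ℕ, ∃ C : ℝ≥0, ∀ t ∈ Icc a b, ∫⁻ x, ‖iteratedFDeriv ℝ n (w (t + s)) x‖ₑ ^ 2 ≤ C :=
  fun n => (h n).imp fun _ hC t ht => hC (t + s) ⟨by linarith [ht.1], by linarith [ht.2]⟩

/-- **Robustness of regularity on `ℝ³` in strain form on an arbitrary window `[t₀, t₁]`, with the
accumulated envelopes written as integrals (RRS 2016, Thm 9.1 / Exercise 9.4 shape (9.1);
Dashti–Robinson 2008, Thm 1), a priori, explicit.** Let `(u, p)` (force `f`, the reference) and
`(v, q)` (force `g`) be classical solutions on `[t₀, t₁] × ℝ³`, `t₀ < t₁`, in the `L²`-Sobolev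
class, and let continuous majorants on `[t₀, t₁]` be given: `−⟪Du(s,x)ξ, ξ⟫ ≤ G(s)‖ξ‖²`,
`‖D²u(s,x)‖ ≤ σ₂(s)`, `‖(v − u)(s)‖_{L²} ≤ L(s)`,
`ψ(s) ≥ (2/ν)‖f(s) − g(s)‖²_{L²} + (3σ₂(s)/κ)L(s)²`, `κ > 0`. Put `λ = 4G + 3κσ₂`,
`Λ(t) = ∫_{t₀}^{t} λ`, `β = A⁴/(2ν³)` (`A` any constant with `AgmonBoundR3 A`), `η = ∫|∇(v − u)(t₀)|²_F + ∫_{t₀}^{t₁} ψ`.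
If `2βe^{2Λ(t₁)}η²(t₁ − t₀) < 1` then for every `t ∈ [t₀, t₁]`
`∫|∇(v − u)(t)|²_F ≤ e^{Λ(t)}η/√(1 − 2βe^{2Λ(t₁)}η²(t − t₀))`
(`classicalNS_robustness_strain_R3` after the time translation `IsClassicalNSSolutionOn.comp_add_right`,
with `Φ = ∫ψ ≥ ∫e^{−Λ}ψ`). [cite: RobinsonRodrigoSadowskiCUP2016, Thm 9.1 with (9.1) and Exercise 9.4; DashtiRobinson2008, Thm 1] -/
theorem classicalNS_robustness_strain_window_of_agmonBound {A : ℝ} (hA : AgmonBoundR3 A) (hν : 0 < ν) (ht₀₁ : t₀ < t₁)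
    (hv : IsClassicalNSSolutionOn (Icc t₀ t₁) ν g v q)
    (hu : IsClassicalNSSolutionOn (Icc t₀ t₁) ν f u p)
    (hU : HasBoundedSobolevNormsOn (Icc t₀ t₁) u)
    (hUt : HasBoundedSobolevNormsOn (Icc t₀ t₁) (timeDerivWithin (Icc t₀ t₁) u))
    (hp : ∀ n : ℕ, ∃ C : ℝ≥0, ∀ t ∈ Icc t₀ t₁, ∫⁻ x, ‖iteratedFDeriv ℝ n (p t) x‖ₑ ^ 2 ≤ C)
    (hV : HasBoundedSobolevNormsOn (Icc t₀ t₁) v)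
    (hVt : HasBoundedSobolevNormsOn (Icc t₀ t₁) (timeDerivWithin (Icc t₀ t₁) v))
    (hq : ∀ n : ℕ, ∃ C : ℝ≥0, ∀ t ∈ Icc t₀ t₁, ∫⁻ x, ‖iteratedFDeriv ℝ n (q t) x‖ₑ ^ 2 ≤ C)
    {G σ₂ L ψ : ℝ → ℝ} {κ : ℝ} (hκ : 0 < κ)
    (hG : ∀ s ∈ Icc t₀ t₁, ∀ (x ξ : EuclideanSpace ℝ (Fin 3)),
      -⟪fderiv ℝ (u s) x ξ, ξ⟫ ≤ G s * ‖ξ‖ ^ 2)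
    (hσ₂ : ∀ s ∈ Icc t₀ t₁, ∀ x, ‖iteratedFDeriv ℝ 2 (u s) x‖ ≤ σ₂ s)
    (hL : ∀ s ∈ Icc t₀ t₁, Real.sqrt (∫ x, ‖(v - u) s x‖ ^ 2) ≤ L s)
    (hψ : ∀ s ∈ Icc t₀ t₁, 2 / ν * (∫ x, ‖f s x - g s x‖ ^ 2) + 3 * σ₂ s / κ * L s ^ 2 ≤ ψ s)
    (hGc : ContinuousOn G (Icc t₀ t₁)) (hσc : ContinuousOn σ₂ (Icc t₀ t₁))
    (hψc : ContinuousOn ψ (Icc t₀ t₁))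
    (hsmall : 2 * (A ^ 4 / (2 * ν ^ 3) *
        Real.exp (2 * ∫ s in t₀..t₁, (4 * G s + 3 * κ * σ₂ s))) *
      ((∫ x, frobeniusNormSq (fderiv ℝ ((v - u) t₀) x)) + ∫ s in t₀..t₁, ψ s) ^ 2 * (t₁ - t₀) < 1)
    {t : ℝ} (ht : t ∈ Icc t₀ t₁) :
    ∫ x, frobeniusNormSq (fderiv ℝ ((v - u) t) x) ≤
      Real.exp (∫ s in t₀..t, (4 * G s + 3 * κ * σ₂ s)) *
          ((∫ x, frobeniusNormSq (fderiv ℝ ((v - u) t₀) x)) + ∫ s in t₀..t₁, ψ s) /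
        Real.sqrt (1 - 2 * (A ^ 4 / (2 * ν ^ 3) *
            Real.exp (2 * ∫ s in t₀..t₁, (4 * G s + 3 * κ * σ₂ s))) *
          ((∫ x, frobeniusNormSq (fderiv ℝ ((v - u) t₀) x)) + ∫ s in t₀..t₁, ψ s) ^ 2 * (t - t₀)) := by
  have hT : 0 < t₁ - t₀ := sub_pos.2 ht₀₁
  -- the translated window `[0, t₁ − t₀]`
  have hpre : (fun s => s + t₀) ⁻¹' Icc t₀ t₁ = Icc 0 (t₁ - t₀) := by
    rw [Set.preimage_add_const_Icc, sub_self]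
  have hmem : ∀ {s}, s ∈ Icc 0 (t₁ - t₀) → s + t₀ ∈ Icc t₀ t₁ := fun hs =>
    ⟨by linarith [hs.1], by linarith [hs.2]⟩
  have hmaps : MapsTo (fun s => s + t₀) (Icc 0 (t₁ - t₀)) (Icc t₀ t₁) := fun s hs => hmem hs
  -- the translated solutions and their class
  have hu' : IsClassicalNSSolutionOn (Icc 0 (t₁ - t₀)) ν (fun s => f (s + t₀)) (fun s => u (s + t₀))
      (fun s => p (s + t₀)) := by
    have h := hu.comp_add_right t₀
    rwa [hpre] at h
  have hv' : IsClassicalNSSolutionOn (Icc 0 (t₁ - t₀)) ν (fun s => g (s + t₀)) (fun s => v (s + t₀))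
      (fun s => q (s + t₀)) := by
    have h := hv.comp_add_right t₀
    rwa [hpre] at h
  have hIcc : Icc t₀ t₁ = Icc (0 + t₀) (t₁ - t₀ + t₀) := by rw [zero_add, sub_add_cancel]
  have hU' : HasBoundedSobolevNormsOn (Icc 0 (t₁ - t₀)) (fun s => u (s + t₀)) := by
    rw [hIcc] at hU
    exact agp_bounds_comp_add hU
  have hV' : HasBoundedSobolevNormsOn (Icc 0 (t₁ - t₀)) (fun s => v (s + t₀)) := by
    rw [hIcc] at hV
    exact agp_bounds_comp_add hV
  have hWeq : ∀ (w : ℝ → EuclideanSpace ℝ (Fin 3) → EuclideanSpace ℝ (Fin 3)),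
      timeDerivWithin (Icc 0 (t₁ - t₀)) (fun s => w (s + t₀)) =
        fun s => timeDerivWithin (Icc t₀ t₁) w (s + t₀) := by
    intro w
    funext s x
    rw [← hpre]
    exact timeDerivWithin_comp_add_right (Icc t₀ t₁) w t₀ s x
  have hUt' : HasBoundedSobolevNormsOn (Icc 0 (t₁ - t₀))
      (timeDerivWithin (Icc 0 (t₁ - t₀)) (fun s => u (s + t₀))) := by
    rw [hWeq u]
    have h2 : ∀ n : ℕ, ∃ C : ℝ≥0, ∀ s ∈ Icc (0 + t₀) (t₁ - t₀ + t₀),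
        ∫⁻ x, ‖iteratedFDeriv ℝ n (timeDerivWithin (Icc t₀ t₁) u s) x‖ₑ ^ 2 ≤ C := by
      rw [← hIcc]; exact hUt
    exact agp_bounds_comp_add h2
  have hVt' : HasBoundedSobolevNormsOn (Icc 0 (t₁ - t₀))
      (timeDerivWithin (Icc 0 (t₁ - t₀)) (fun s => v (s + t₀))) := by
    rw [hWeq v]
    have h2 : ∀ n : ℕ, ∃ C : ℝ≥0, ∀ s ∈ Icc (0 + t₀) (t₁ - t₀ + t₀),
        ∫⁻ x, ‖iteratedFDeriv ℝ n (timeDerivWithin (Icc t₀ t₁) v s) x‖ₑ ^ 2 ≤ C := by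
      rw [← hIcc]; exact hVt
    exact agp_bounds_comp_add h2
  have hp' : ∀ n : ℕ, ∃ C : ℝ≥0, ∀ s ∈ Icc 0 (t₁ - t₀),
      ∫⁻ x, ‖iteratedFDeriv ℝ n (p (s + t₀)) x‖ₑ ^ 2 ≤ C := by
    rw [hIcc] at hp
    exact agp_bounds_comp_add hp
  have hq' : ∀ n : ℕ, ∃ C : ℝ≥0, ∀ s ∈ Icc 0 (t₁ - t₀),
      ∫⁻ x, ‖iteratedFDeriv ℝ n (q (s + t₀)) x‖ₑ ^ 2 ≤ C := by
    rw [hIcc] at hq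
    exact agp_bounds_comp_add hq
  -- the translated majorants and envelopes
  have cadd : Continuous fun s : ℝ => s + t₀ := continuous_id.add continuous_const
  have hlc : ContinuousOn (fun s => 4 * G (s + t₀) + 3 * κ * σ₂ (s + t₀)) (Icc 0 (t₁ - t₀)) :=
    (continuousOn_const.mul (hGc.comp cadd.continuousOn hmaps)).add
      (continuousOn_const.mul (hσc.comp cadd.continuousOn hmaps))
  have hψc' : ContinuousOn (fun s => ψ (s + t₀)) (Icc 0 (t₁ - t₀)) :=
    hψc.comp cadd.continuousOn hmaps
  have hσ0 : ∀ s ∈ Icc t₀ t₁, 0 ≤ σ₂ s := fun s hs => (norm_nonneg _).trans (hσ₂ s hs 0)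
  have hG0 : ∀ s ∈ Icc t₀ t₁, 0 ≤ G s := fun s hs =>
    compressionRate_nonneg_of_isDivFree (hu.divFree s hs) (hG s hs)
  have hl0 : ∀ s ∈ Icc t₀ t₁, 0 ≤ 4 * G s + 3 * κ * σ₂ s := fun s hs => by
    have := hG0 s hs
    have := hσ0 s hs
    positivity
  have hψ0 : ∀ s ∈ Icc t₀ t₁, 0 ≤ ψ s := fun s hs => by
    refine le_trans ?_ (hψ s hs)
    have : 0 ≤ ∫ x, ‖f s x - g s x‖ ^ 2 := integral_nonneg fun x => sq_nonneg _
    have := hσ0 s hs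
    positivity
  have hΛ : ∀ s ∈ Icc 0 (t₁ - t₀),
      HasDerivWithinAt (fun r => ∫ x in (0 : ℝ)..r, (4 * G (x + t₀) + 3 * κ * σ₂ (x + t₀)))
        (4 * G (s + t₀) + 3 * κ * σ₂ (s + t₀)) (Icc 0 (t₁ - t₀)) s := fun s hs =>
    agp_hasDerivWithinAt_intervalIntegral hlc hs
  have hΦ : ∀ s ∈ Icc 0 (t₁ - t₀),
      HasDerivWithinAt (fun r => ∫ x in (0 : ℝ)..r, ψ (x + t₀)) (ψ (s + t₀)) (Icc 0 (t₁ - t₀)) s :=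
    fun s hs => agp_hasDerivWithinAt_intervalIntegral hψc' hs
  have hΛnn : ∀ s ∈ Icc 0 (t₁ - t₀),
      0 ≤ ∫ x in (0 : ℝ)..s, (4 * G (x + t₀) + 3 * κ * σ₂ (x + t₀)) := fun s hs =>
    intervalIntegral.integral_nonneg hs.1 fun x hx => hl0 (x + t₀) (hmem ⟨hx.1, hx.2.trans hs.2⟩)
  have hφ : ∀ s ∈ Icc 0 (t₁ - t₀),
      Real.exp (-(fun r => ∫ x in (0 : ℝ)..r, (4 * G (x + t₀) + 3 * κ * σ₂ (x + t₀))) s) *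
        ψ (s + t₀) ≤ ψ (s + t₀) := fun s hs =>
    mul_le_of_le_one_left (hψ0 (s + t₀) (hmem hs))
      (Real.exp_le_one_iff.2 (neg_nonpos.2 (hΛnn s hs)))
  -- change of variables in the envelopes
  have eΛ : ∀ r, (∫ x in (0 : ℝ)..r, (4 * G (x + t₀) + 3 * κ * σ₂ (x + t₀))) =
      ∫ s in t₀..(r + t₀), (4 * G s + 3 * κ * σ₂ s) := fun r => by
    rw [intervalIntegral.integral_comp_add_right (fun s => 4 * G s + 3 * κ * σ₂ s), zero_add]
  have eΦ : ∀ r, (∫ x in (0 : ℝ)..r, ψ (x + t₀)) = ∫ s in t₀..(r + t₀), ψ s := fun r => by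
    rw [intervalIntegral.integral_comp_add_right ψ, zero_add]
  -- the translated slices at `t − t₀` and `0`
  have hr : t - t₀ ∈ Icc 0 (t₁ - t₀) := ⟨sub_nonneg.2 ht.1, sub_le_sub_right ht.2 _⟩
  have e1 : ((fun s => v (s + t₀)) - fun s => u (s + t₀)) (t - t₀) = (v - u) t := by
    funext x
    simp only [Pi.sub_apply, sub_add_cancel]
  have e0 : ((fun s => v (s + t₀)) - fun s => u (s + t₀)) 0 = (v - u) t₀ := by
    funext x
    simp only [Pi.sub_apply, zero_add]
  have key := classicalNS_robustness_strain_of_agmonBound hA hν hT hv' hu' hU' hUt' hp' hV' hVt' hq'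
    (G := fun s => G (s + t₀)) (σ₂ := fun s => σ₂ (s + t₀)) (L := fun s => L (s + t₀))
    (ψ := fun s => ψ (s + t₀))
    (Λ := fun r => ∫ x in (0 : ℝ)..r, (4 * G (x + t₀) + 3 * κ * σ₂ (x + t₀)))
    (Φ := fun r => ∫ x in (0 : ℝ)..r, ψ (x + t₀)) (φ := fun s => ψ (s + t₀)) hκ
    (fun s hs => hG (s + t₀) (hmem hs)) (fun s hs => hσ₂ (s + t₀) (hmem hs))
    (fun s hs => hL (s + t₀) (hmem hs)) (fun s hs => hψ (s + t₀) (hmem hs))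
    (hGc.comp cadd.continuousOn hmaps) (hσc.comp cadd.continuousOn hmaps) hψc' hΛ
    (by simp only [intervalIntegral.integral_same]) hΦ
    (by simp only [intervalIntegral.integral_same]) hφ ?_ hr
  · -- unpack the translated conclusion
    rw [e1, e0] at key
    simp only [eΛ, eΦ, sub_add_cancel] at key
    exact key
  · rw [e0]
    simp only [eΛ, eΦ, sub_add_cancel]
    exact hsmall

/-- **Window form with MAJORANTS of the two defects** (the literal certificate shape): in the
setting of `classicalNS_robustness_strain_window_R3`, if `∫|∇(v − u)(t₀)|²_F ≤ D` (datum defect)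
and `∫_{t₀}^{t₁} ψ ≤ Ψ` (accumulated residual budget), `η' = D + Ψ`, and
`2βe^{2Λ(t₁)}η'²(t₁ − t₀) < 1`, then `∫|∇(v − u)(t)|²_F ≤ e^{Λ(t)}η'/√(1 − 2βe^{2Λ(t₁)}η'²(t − t₀))`
on `[t₀, t₁]` (the bound is monotone in `η`). [cite: RobinsonRodrigoSadowskiCUP2016, Thm 9.1 with (9.1) and Exercise 9.4; DashtiRobinson2008, Thm 1 and Thm 5 (i)] -/
theorem classicalNS_robustness_strain_window_of_le_of_agmonBound {A : ℝ} (hA : AgmonBoundR3 A) (hν : 0 < ν) (ht₀₁ : t₀ < t₁)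
    (hv : IsClassicalNSSolutionOn (Icc t₀ t₁) ν g v q)
    (hu : IsClassicalNSSolutionOn (Icc t₀ t₁) ν f u p)
    (hU : HasBoundedSobolevNormsOn (Icc t₀ t₁) u)
    (hUt : HasBoundedSobolevNormsOn (Icc t₀ t₁) (timeDerivWithin (Icc t₀ t₁) u))
    (hp : ∀ n : ℕ, ∃ C : ℝ≥0, ∀ t ∈ Icc t₀ t₁, ∫⁻ x, ‖iteratedFDeriv ℝ n (p t) x‖ₑ ^ 2 ≤ C)
    (hV : HasBoundedSobolevNormsOn (Icc t₀ t₁) v)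
    (hVt : HasBoundedSobolevNormsOn (Icc t₀ t₁) (timeDerivWithin (Icc t₀ t₁) v))
    (hq : ∀ n : ℕ, ∃ C : ℝ≥0, ∀ t ∈ Icc t₀ t₁, ∫⁻ x, ‖iteratedFDeriv ℝ n (q t) x‖ₑ ^ 2 ≤ C)
    {G σ₂ L ψ : ℝ → ℝ} {κ D Ψ : ℝ} (hκ : 0 < κ)
    (hG : ∀ s ∈ Icc t₀ t₁, ∀ (x ξ : EuclideanSpace ℝ (Fin 3)),
      -⟪fderiv ℝ (u s) x ξ, ξ⟫ ≤ G s * ‖ξ‖ ^ 2)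
    (hσ₂ : ∀ s ∈ Icc t₀ t₁, ∀ x, ‖iteratedFDeriv ℝ 2 (u s) x‖ ≤ σ₂ s)
    (hL : ∀ s ∈ Icc t₀ t₁, Real.sqrt (∫ x, ‖(v - u) s x‖ ^ 2) ≤ L s)
    (hψ : ∀ s ∈ Icc t₀ t₁, 2 / ν * (∫ x, ‖f s x - g s x‖ ^ 2) + 3 * σ₂ s / κ * L s ^ 2 ≤ ψ s)
    (hGc : ContinuousOn G (Icc t₀ t₁)) (hσc : ContinuousOn σ₂ (Icc t₀ t₁))
    (hψc : ContinuousOn ψ (Icc t₀ t₁))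
    (hD : ∫ x, frobeniusNormSq (fderiv ℝ ((v - u) t₀) x) ≤ D)
    (hΨ : ∫ s in t₀..t₁, ψ s ≤ Ψ)
    (hsmall : 2 * (A ^ 4 / (2 * ν ^ 3) *
        Real.exp (2 * ∫ s in t₀..t₁, (4 * G s + 3 * κ * σ₂ s))) * (D + Ψ) ^ 2 * (t₁ - t₀) < 1)
    {t : ℝ} (ht : t ∈ Icc t₀ t₁) :
    ∫ x, frobeniusNormSq (fderiv ℝ ((v - u) t) x) ≤
      Real.exp (∫ s in t₀..t, (4 * G s + 3 * κ * σ₂ s)) * (D + Ψ) /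
        Real.sqrt (1 - 2 * (A ^ 4 / (2 * ν ^ 3) *
            Real.exp (2 * ∫ s in t₀..t₁, (4 * G s + 3 * κ * σ₂ s))) * (D + Ψ) ^ 2 * (t - t₀)) := by
  -- abbreviations
  obtain ⟨c, hc⟩ : ∃ c : ℝ, c = 2 * (A ^ 4 / (2 * ν ^ 3) *
      Real.exp (2 * ∫ s in t₀..t₁, (4 * G s + 3 * κ * σ₂ s))) := ⟨_, rfl⟩
  obtain ⟨η, hη⟩ : ∃ η : ℝ, η = (∫ x, frobeniusNormSq (fderiv ℝ ((v - u) t₀) x)) +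
      ∫ s in t₀..t₁, ψ s := ⟨_, rfl⟩
  have hc0 : 0 ≤ c := by
    rw [hc]
    have := hA.nonneg
    positivity
  have hX0 : 0 ≤ ∫ x, frobeniusNormSq (fderiv ℝ ((v - u) t₀) x) :=
    integral_nonneg fun x => frobeniusNormSq_nonneg _
  have hσ0 : ∀ s ∈ Icc t₀ t₁, 0 ≤ σ₂ s := fun s hs => (norm_nonneg _).trans (hσ₂ s hs 0)
  have hψ0 : ∀ s ∈ Icc t₀ t₁, 0 ≤ ψ s := fun s hs => by
    refine le_trans ?_ (hψ s hs)
    have : 0 ≤ ∫ x, ‖f s x - g s x‖ ^ 2 := integral_nonneg fun x => sq_nonneg _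
    have := hσ0 s hs
    positivity
  have hΨ0 : 0 ≤ ∫ s in t₀..t₁, ψ s := intervalIntegral.integral_nonneg ht₀₁.le hψ0
  have hη0 : 0 ≤ η := by rw [hη]; exact add_nonneg hX0 hΨ0
  have hηη' : η ≤ D + Ψ := by rw [hη]; exact add_le_add hD hΨ
  have hT0 : 0 ≤ t₁ - t₀ := sub_nonneg.2 ht₀₁.le
  -- the smallness condition for the exact `η`
  have hsq : η ^ 2 ≤ (D + Ψ) ^ 2 := pow_le_pow_left₀ hη0 hηη' 2
  have hsmall' : c * η ^ 2 * (t₁ - t₀) < 1 := by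
    have h1 : c * η ^ 2 * (t₁ - t₀) ≤ c * (D + Ψ) ^ 2 * (t₁ - t₀) :=
      mul_le_mul_of_nonneg_right (mul_le_mul_of_nonneg_left hsq hc0) hT0
    have h2 : c * (D + Ψ) ^ 2 * (t₁ - t₀) < 1 := by rw [hc]; exact hsmall
    linarith
  have key := classicalNS_robustness_strain_window_of_agmonBound hA hν ht₀₁ hv hu hU hUt hp hV hVt hq hκ hG hσ₂ hL
    hψ hGc hσc hψc (by rw [← hc, ← hη]; exact hsmall') ht
  rw [← hc, ← hη] at key
  rw [← hc]
  refine key.trans ?_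
  -- monotonicity of the bound in `η`
  have hpos : 0 < 1 - c * (D + Ψ) ^ 2 * (t - t₀) := by
    have h1 : c * (D + Ψ) ^ 2 * (t - t₀) ≤ c * (D + Ψ) ^ 2 * (t₁ - t₀) :=
      mul_le_mul_of_nonneg_left (sub_le_sub_right ht.2 _) (by positivity)
    have h2 : c * (D + Ψ) ^ 2 * (t₁ - t₀) < 1 := by rw [hc]; exact hsmall
    linarith
  exact agp_bound_mono hc0 hη0 hηη' (sub_nonneg.2 ht.1) hpos

end Window

end Literature.Analysis.FluidPDE
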